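import Literature.Probability.Percolation.LonelyClusterExchange
import HarnessLib

/-!
# `NoHeavyLowerTail` (stmt-CriticalPhenomena-4575), swap / merge-stability line — the RATIO FORM of the
# champion-stability inequality CS₂ (hypothesis-free, from BHK 2006 Thm. 1.5)

Route `PercNearOneGluingNoHeavy`, seat `prim-gen-swap` (gen 4).  Bond percolation `μ = prodBernoulli w` with
arbitrary edge probabilities on a finite vertex type, a finite relay set `A`, a level `j`; `π(v)` = the relays
joined to `v`, `R_v = {|π(v)| ≤ j}`.

The registered stub `stub_championStabilityPair` (CS₂) asks, for a champion `c` and a pair of observers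
`x, y`, that `μ(c ↮ x, c ↮ y, 1 ≤ |π(x) ∪ π(y)| ≤ j) ≤ μ(c ↮ x, c ↮ y, |π(c)| ≤ j)`.  The tree proves it when
`μ(R_y) ≤ μ(R_c)` (`Literature…twoObserver_le_of_lonelier`); the open case is a pair of Steiner observers both
strictly LIGHTER than the champion (`μ(R_y) > μ(R_c)`), where lightness comes from the silent mass `{π(y) = ∅}`.
This file records the exact, HYPOTHESIS-FREE content of the same exchange argument:

* `TwoObserverRatio.exchange_compl` — the lonely-cluster exchange in complement form: with `D = {y ↮ c}`,
  `μ(D ∩ R_c ∩ {c ↮ x}) · μ(D ∩ R_y) ≥ μ(D ∩ R_c) · μ(D ∩ R_y ∩ {c ↮ x})`;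
* `twoObserver_ratio` — **ratio form of CS₂**: for ALL vertices `x, y, c` (no comparison hypothesis),

    `μ(y ↮ c, |π(c)| ≤ j) · μ(c ↮ x, c ↮ y, 1 ≤ |π(x) ∪ π(y)| ≤ j)
        ≤ μ(y ↮ c, |π(y)| ≤ j) · μ(c ↮ x, c ↮ y, |π(c)| ≤ j)`,

  i.e. CS₂ holds up to the factor `μ(R_y, y ↮ c) / μ(R_c, y ↮ c)`; since `μ(R_y) − μ(R_c) = μ(R_y, y ↮ c) −
  μ(R_c, y ↮ c)`, the factor is `≤ 1` exactly when `y` is no lighter than `c`, which recovers the tree theorem,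
  and in the light case it quantifies the deficit as the lightness excess `μ(R_y) − μ(R_c)` times the
  conditional probability `μ(c ↮ x, c ↮ y, 1 ≤ |π(x) ∪ π(y)| ≤ j) / μ(R_y, y ↮ c)`.
* `twoObserver_of_ratio_le_one` — the linear consequence under `μ(R_y ∩ {y ↮ c}) ≤ μ(R_c ∩ {y ↮ c})`.

No definitions, no named facts, no sorries.

## References
* J. van den Berg, O. Häggström, J. Kahn, *Some conditional correlation inequalities for percolation and
  related processes*, Random Structures Algorithms 29 (2006) 417–435, Thm. 1.5. [VandenbergHaggstromKahn2005]
-/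

noncomputable section

namespace Summit.CriticalPhenomena.PercolationContinuityZ3.Theorems

open MeasureTheory Set
open Literature.Probability.LatticeModels (prodBernoulli)
open Literature.Probability.Percolation
open scoped Classical

variable {V : Type*}

namespace TwoObserverRatio

/-- **Lonely-cluster exchange, complement form.**  For `y ≠ c`, `D = {y ↮ c}`, `X = {c ↔ x}`:
`μ(D ∩ R_c) · μ(D ∩ R_y ∩ Xᶜ) ≤ μ(D ∩ R_c ∩ Xᶜ) · μ(D ∩ R_y)`.  (From `lonelyClusterExchange`
`μ(D ∩ R_c ∩ X) μ(D ∩ R_y) ≤ μ(D ∩ R_c) μ(D ∩ X ∩ R_y)` by splitting `D ∩ R_c` and `D ∩ R_y` along `X`.)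
[cite: VandenbergHaggstromKahn2005, Thm. 1.5 (p. 7) — corollary, derived in this file] -/
theorem exchange_compl [Fintype V] (w : Sym2 V → unitInterval) {y c : V} (hyc : y ≠ c) (x : V)
    (A : Finset V) (j : ℕ) :
    (prodBernoulli w).real ((openConn y c)ᶜ ∩
        {ω : BondConfig V | (A.filter fun z => ω ∈ openConn c z).card ≤ j}) *
      (prodBernoulli w).real (((openConn y c)ᶜ ∩
        {ω : BondConfig V | (A.filter fun z => ω ∈ openConn y z).card ≤ j}) \ openConn c x) ≤
    (prodBernoulli w).real (((openConn y c)ᶜ ∩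
        {ω : BondConfig V | (A.filter fun z => ω ∈ openConn c z).card ≤ j}) \ openConn c x) *
      (prodBernoulli w).real ((openConn y c)ᶜ ∩
        {ω : BondConfig V | (A.filter fun z => ω ∈ openConn y z).card ≤ j}) := by
  set μ := prodBernoulli w with hμ
  set Rc : Set (BondConfig V) := {ω | (A.filter fun z => ω ∈ openConn c z).card ≤ j} with hRc
  set Ry : Set (BondConfig V) := {ω | (A.filter fun z => ω ∈ openConn y z).card ≤ j} with hRy
  set D : Set (BondConfig V) := (openConn y c)ᶜ with hD
  set X : Set (BondConfig V) := openConn c x with hX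
  have hmeas : ∀ S : Set (BondConfig V), MeasurableSet S := fun S => (Set.toFinite S).measurableSet
  -- the exchange with `s = y`, `t = c`
  have key : μ.real (D ∩ (Rc ∩ X)) * μ.real (D ∩ Ry) ≤ μ.real (D ∩ Rc) * μ.real (D ∩ (X ∩ Ry)) :=
    lonelyClusterExchange w hyc x A j
  have hc : μ.real (D ∩ Rc ∩ X) + μ.real ((D ∩ Rc) \ X) = μ.real (D ∩ Rc) :=
    measureReal_inter_add_sdiff (hmeas X)
  have hy : μ.real (D ∩ Ry ∩ X) + μ.real ((D ∩ Ry) \ X) = μ.real (D ∩ Ry) :=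
    measureReal_inter_add_sdiff (hmeas X)
  have e1 : D ∩ Rc ∩ X = D ∩ (Rc ∩ X) := by
    ext ω; simp only [mem_inter_iff]; tauto
  have e2 : D ∩ Ry ∩ X = D ∩ (X ∩ Ry) := by
    ext ω; simp only [mem_inter_iff]; tauto
  rw [e1] at hc
  rw [e2] at hy
  have h1 : μ.real (D ∩ (Rc ∩ X)) = μ.real (D ∩ Rc) - μ.real ((D ∩ Rc) \ X) := by linarith
  have h2 : μ.real (D ∩ (X ∩ Ry)) = μ.real (D ∩ Ry) - μ.real ((D ∩ Ry) \ X) := by linarith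
  rw [h1, h2] at key
  nlinarith [measureReal_nonneg (μ := μ) (s := D ∩ Rc), measureReal_nonneg (μ := μ) (s := D ∩ Ry),
    measureReal_nonneg (μ := μ) (s := (D ∩ Rc) \ X), measureReal_nonneg (μ := μ) (s := (D ∩ Ry) \ X)]

end TwoObserverRatio

open TwoObserverRatio in
/-- **Ratio form of the champion-stability inequality CS₂ (hypothesis-free).**  For vertices `x, y, c`,
a finite `A`, a level `j`, with `R_v = {|π(v)| ≤ j}` and `π(x) ∪ π(y)` the Finset
`A.filter (fun z => x ↔ z ∨ y ↔ z)`: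

  `μ(y ↮ c, R_c) · μ(c ↮ x, c ↮ y, 1 ≤ |π(x) ∪ π(y)| ≤ j) ≤ μ(y ↮ c, R_y) · μ(c ↮ x, c ↮ y, R_c)`.

So CS₂ (`stub_championStabilityPair` of stmt-CriticalPhenomena-4575) holds up to the factor
`μ(R_y, y ↮ c)/μ(R_c, y ↮ c)`, which is `≤ 1` iff `μ(R_y) ≤ μ(R_c)` (the two loneliness events agree on
`{y ↔ c}`); the open light-Steiner case of CS₂ is exactly the statement that the lightness excess
`μ(R_y) − μ(R_c) > 0` is paid for.  Proof: the left event lies in `{y ↮ c} ∩ R_y ∩ {c ↮ x}`, the right event is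
`{y ↮ c} ∩ R_c ∩ {c ↮ x}`, and `exchange_compl`.
[cite: VandenbergHaggstromKahn2005, Thm. 1.5 (p. 7) — corollary, derived in this file] -/
theorem twoObserver_ratio [Fintype V] (w : Sym2 V → unitInterval) (A : Finset V) (x y c : V) (j : ℕ) :
    (prodBernoulli w).real ((openConn y c)ᶜ ∩
        {ω : BondConfig V | (A.filter fun z => ω ∈ openConn c z).card ≤ j}) *
      (prodBernoulli w).real {ω : BondConfig V | ω ∉ openConn c x ∧ ω ∉ openConn c y ∧
        1 ≤ (A.filter fun z => ω ∈ openConn x z ∨ ω ∈ openConn y z).card ∧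
        (A.filter fun z => ω ∈ openConn x z ∨ ω ∈ openConn y z).card ≤ j} ≤
    (prodBernoulli w).real ((openConn y c)ᶜ ∩
        {ω : BondConfig V | (A.filter fun z => ω ∈ openConn y z).card ≤ j}) *
      (prodBernoulli w).real {ω : BondConfig V | ω ∉ openConn c x ∧ ω ∉ openConn c y ∧
        (A.filter fun z => ω ∈ openConn c z).card ≤ j} := by
  set μ := prodBernoulli w with hμ
  set Rc : Set (BondConfig V) := {ω | (A.filter fun z => ω ∈ openConn c z).card ≤ j} with hRc
  set Ry : Set (BondConfig V) := {ω | (A.filter fun z => ω ∈ openConn y z).card ≤ j} with hRy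
  set D : Set (BondConfig V) := (openConn y c)ᶜ with hD
  set X : Set (BondConfig V) := openConn c x with hX
  have hmeas : ∀ S : Set (BondConfig V), MeasurableSet S := fun S => (Set.toFinite S).measurableSet
  by_cases hyc : y = c
  · subst hyc
    have hempty : {ω : BondConfig V | ω ∉ openConn y x ∧ ω ∉ openConn y y ∧
        1 ≤ (A.filter fun z => ω ∈ openConn x z ∨ ω ∈ openConn y z).card ∧
        (A.filter fun z => ω ∈ openConn x z ∨ ω ∈ openConn y z).card ≤ j} = ∅ := by
      ext ω
      simp only [mem_setOf_eq, mem_empty_iff_false, iff_false, not_and]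
      intro _ h
      exact absurd (SimpleGraph.Reachable.refl y : (openGraph ω).Reachable y y) h
    rw [hempty, measureReal_empty, mul_zero]
    exact mul_nonneg measureReal_nonneg measureReal_nonneg
  have hsymm : (openConn y c : Set (BondConfig V)) = openConn c y :=
    Set.ext fun _ => ⟨SimpleGraph.Reachable.symm, SimpleGraph.Reachable.symm⟩
  have hR : {ω : BondConfig V | ω ∉ openConn c x ∧ ω ∉ openConn c y ∧
      (A.filter fun z => ω ∈ openConn c z).card ≤ j} = (D ∩ Rc) \ X := by
    ext ω
    simp only [hRc, hD, hX, mem_sdiff, mem_inter_iff, mem_compl_iff, mem_setOf_eq, hsymm]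
    tauto
  have hL : {ω : BondConfig V | ω ∉ openConn c x ∧ ω ∉ openConn c y ∧
      1 ≤ (A.filter fun z => ω ∈ openConn x z ∨ ω ∈ openConn y z).card ∧
      (A.filter fun z => ω ∈ openConn x z ∨ ω ∈ openConn y z).card ≤ j} ⊆ (D ∩ Ry) \ X := by
    intro ω hω
    obtain ⟨hcx, hcy, -, hU⟩ := hω
    simp only [hRy, hD, hX, mem_sdiff, mem_inter_iff, mem_compl_iff, mem_setOf_eq, hsymm]
    refine ⟨⟨hcy, le_trans (Finset.card_le_card ?_) hU⟩, hcx⟩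
    intro z hz
    rw [Finset.mem_filter] at hz ⊢
    exact ⟨hz.1, Or.inr hz.2⟩
  rw [hR]
  have hkey := exchange_compl w hyc x A j
  calc μ.real (D ∩ Rc) * μ.real {ω : BondConfig V | ω ∉ openConn c x ∧ ω ∉ openConn c y ∧
          1 ≤ (A.filter fun z => ω ∈ openConn x z ∨ ω ∈ openConn y z).card ∧
          (A.filter fun z => ω ∈ openConn x z ∨ ω ∈ openConn y z).card ≤ j}
        ≤ μ.real (D ∩ Rc) * μ.real ((D ∩ Ry) \ X) :=
          mul_le_mul_of_nonneg_left (measureReal_mono hL) measureReal_nonneg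
    _ ≤ μ.real ((D ∩ Rc) \ X) * μ.real (D ∩ Ry) := hkey
    _ = μ.real (D ∩ Ry) * μ.real ((D ∩ Rc) \ X) := mul_comm _ _

/-- **CS₂ from the ratio form.**  If `μ(R_y ∩ {y ↮ c}) ≤ μ(R_c ∩ {y ↮ c})` (equivalently `μ(R_y) ≤ μ(R_c)`),
then `μ(c ↮ x, c ↮ y, 1 ≤ |π(x) ∪ π(y)| ≤ j) ≤ μ(c ↮ x, c ↮ y, |π(c)| ≤ j)` — the tree's
`twoObserver_le_of_lonelier`, re-derived as the case "factor ≤ 1" of `twoObserver_ratio`.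
[cite: VandenbergHaggstromKahn2005, Thm. 1.5 (p. 7) — corollary, derived in this file] -/
theorem twoObserver_of_ratio_le_one [Fintype V] (w : Sym2 V → unitInterval) (A : Finset V) (x y c : V)
    (j : ℕ)
    (hle : (prodBernoulli w).real ((openConn y c)ᶜ ∩
        {ω : BondConfig V | (A.filter fun z => ω ∈ openConn y z).card ≤ j}) ≤
      (prodBernoulli w).real ((openConn y c)ᶜ ∩
        {ω : BondConfig V | (A.filter fun z => ω ∈ openConn c z).card ≤ j})) :
    (prodBernoulli w).real {ω : BondConfig V | ω ∉ openConn c x ∧ ω ∉ openConn c y ∧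
        1 ≤ (A.filter fun z => ω ∈ openConn x z ∨ ω ∈ openConn y z).card ∧
        (A.filter fun z => ω ∈ openConn x z ∨ ω ∈ openConn y z).card ≤ j} ≤
      (prodBernoulli w).real {ω : BondConfig V | ω ∉ openConn c x ∧ ω ∉ openConn c y ∧
        (A.filter fun z => ω ∈ openConn c z).card ≤ j} := by
  set μ := prodBernoulli w with hμ
  have hrat := twoObserver_ratio w A x y c j
  set a := μ.real ((openConn y c)ᶜ ∩
        {ω : BondConfig V | (A.filter fun z => ω ∈ openConn c z).card ≤ j}) with ha
  set b := μ.real ((openConn y c)ᶜ ∩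
        {ω : BondConfig V | (A.filter fun z => ω ∈ openConn y z).card ≤ j}) with hb
  set ℓ := μ.real {ω : BondConfig V | ω ∉ openConn c x ∧ ω ∉ openConn c y ∧
        1 ≤ (A.filter fun z => ω ∈ openConn x z ∨ ω ∈ openConn y z).card ∧
        (A.filter fun z => ω ∈ openConn x z ∨ ω ∈ openConn y z).card ≤ j} with hl
  set ρ := μ.real {ω : BondConfig V | ω ∉ openConn c x ∧ ω ∉ openConn c y ∧
        (A.filter fun z => ω ∈ openConn c z).card ≤ j} with hρ
  -- `ℓ ≤ b` (the left event lies in `R_y ∩ {y ↮ c}`) and `ρ ≤ a`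
  have hsymm : (openConn y c : Set (BondConfig V)) = openConn c y :=
    Set.ext fun _ => ⟨SimpleGraph.Reachable.symm, SimpleGraph.Reachable.symm⟩
  have hlb : ℓ ≤ b := by
    refine measureReal_mono ?_
    intro ω hω
    obtain ⟨-, hcy, -, hU⟩ := hω
    simp only [mem_inter_iff, mem_compl_iff, mem_setOf_eq, hsymm]
    refine ⟨hcy, le_trans (Finset.card_le_card ?_) hU⟩
    intro z hz
    rw [Finset.mem_filter] at hz ⊢
    exact ⟨hz.1, Or.inr hz.2⟩
  have hρa : ρ ≤ a := by
    refine measureReal_mono ?_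
    intro ω hω
    obtain ⟨-, hcy, hc⟩ := hω
    simp only [mem_inter_iff, mem_compl_iff, mem_setOf_eq, hsymm]
    exact ⟨hcy, hc⟩
  have hb0 : 0 ≤ b := measureReal_nonneg
  have hρ0 : 0 ≤ ρ := measureReal_nonneg
  by_cases hb : b = 0
  · have : ℓ = 0 := le_antisymm (hb ▸ hlb) measureReal_nonneg
    rw [this]; exact hρ0
  · have hbpos : 0 < b := lt_of_le_of_ne hb0 (Ne.symm hb)
    -- `a ℓ ≤ b ρ` and `b ≤ a` give `b ℓ ≤ a ℓ ≤ b ρ`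
    have h1 : b * ℓ ≤ b * ρ := by nlinarith [measureReal_nonneg (μ := μ) (s := {ω : BondConfig V |
        ω ∉ openConn c x ∧ ω ∉ openConn c y ∧
        1 ≤ (A.filter fun z => ω ∈ openConn x z ∨ ω ∈ openConn y z).card ∧
        (A.filter fun z => ω ∈ openConn x z ∨ ω ∈ openConn y z).card ≤ j})]
    exact le_of_mul_le_mul_left h1 hbpos

end Summit.CriticalPhenomena.PercolationContinuityZ3.Theorems

end
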